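import Mathlib
import Summits.ValiantsHypothesis.ValiantsHypothesis.Theorems.TwoProducts.Negative.RankObstruction
/-! # Stub `stub_engineCommonCone` — crux `TwoProducts` (stmt-ValiantsHypothesis-5906), line `corner-log-linearization`
   The rank rung of the engine on a common independent tail cone `{α, β}` (`α 0 * β 1 ≠ α 1 * β 0`): every factor is
   `u_i = 1 + a_i X^α + b_i X^β` (`v_i` likewise), the map `(p, q) ↦ p • α + q • β` is injective, so the coefficient
   of `X^{p•α+q•β}` in the truncated log series `Λ_R = Σ_{r=1}^{R} ((−1)^{r+1}/r) • (Σ_i (u_i − 1)^r − Σ_i (v_i − 1)^r)`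
   is `c_{p,q} · G(p,q)` (`1 ≤ p + q ≤ R`, `c_{p,q} ≠ 0`) with `G(p,q) = Σ_i a_i^p b_i^q − Σ_i a'_i^p b'_i^q`, a
   pattern of rank `≤ 2n`.  A stable south-west log vertex is `p • α + q • β` for a MINIMAL nonzero `(p, q)` of `G`
   (componentwise order), and minimal nonzeros of a rank-`≤ 2n` pattern number at most `2n`
   (`Negative.card_corners_le_rank`, a lower-triangular invertible minor).  Hence `#LV ≤ 2n`. [folklore] -/
set_option linter.dupNamespace false -- single-conjunct summit: `ValiantsHypothesis.ValiantsHypothesis`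
namespace Summit.ValiantsHypothesis.ValiantsHypothesis.Theorems.TwoProducts.CommonCone
open scoped BigOperators

/-- Two exponents with nonzero determinant span injectively over `ℕ`: `i • α + j • β = p • α + q • β` forces
`i = p` and `j = q`. [folklore] -/
theorem smul_add_smul_inj {α β : Fin 2 →₀ ℕ} (hdet : α 0 * β 1 ≠ α 1 * β 0) {i j p q : ℕ}
    (h : i • α + j • β = p • α + q • β) : i = p ∧ j = q := by
  have h0 := DFunLike.congr_fun h 0
  have h1 := DFunLike.congr_fun h 1
  simp only [Finsupp.add_apply, Finsupp.smul_apply, smul_eq_mul] at h0 h1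
  have hd : ((α 0 : ℤ) * β 1 - α 1 * β 0) ≠ 0 := by
    intro h'
    apply hdet
    exact_mod_cast (sub_eq_zero.1 h')
  have h0' : (i : ℤ) * α 0 + j * β 0 = p * α 0 + q * β 0 := by exact_mod_cast h0
  have h1' : (i : ℤ) * α 1 + j * β 1 = p * α 1 + q * β 1 := by exact_mod_cast h1
  constructor
  · have : ((i : ℤ) - p) * (α 0 * β 1 - α 1 * β 0) = 0 := by
      linear_combination (β 1 : ℤ) * h0' - (β 0 : ℤ) * h1'
    rcases mul_eq_zero.1 this with h | h
    · exact_mod_cast (sub_eq_zero.1 h)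
    · exact absurd h hd
  · have : ((j : ℤ) - q) * (α 0 * β 1 - α 1 * β 0) = 0 := by
      linear_combination -(α 1 : ℤ) * h0' + (α 0 : ℤ) * h1'
    rcases mul_eq_zero.1 this with h | h
    · exact_mod_cast (sub_eq_zero.1 h)
    · exact absurd h hd

/-- Exponents with nonzero determinant are nonzero and distinct. [folklore] -/
theorem ne_zero_of_det {α β : Fin 2 →₀ ℕ} (hdet : α 0 * β 1 ≠ α 1 * β 0) : α ≠ 0 ∧ β ≠ 0 ∧ α ≠ β := by
  refine ⟨?_, ?_, ?_⟩
  · rintro rfl; apply hdet; simp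
  · rintro rfl; apply hdet; simp
  · rintro rfl; apply hdet; exact Nat.mul_comm _ _

/-- SHAPE: a polynomial with constant term `1` supported inside `{0, α, β}` (`α, β ≠ 0` distinct) is
`1 + a X^α + b X^β` with `a, b` its coefficients at `α, β`. [folklore] -/
theorem sub_one_eq_of_support_subset {α β : Fin 2 →₀ ℕ} (hα : α ≠ 0) (hβ : β ≠ 0) (hαβ : α ≠ β)
    (f : MvPolynomial (Fin 2) ℂ) (h0 : f.coeff 0 = 1) (hs : f.support ⊆ {0, α, β}) :
    f - 1 = MvPolynomial.monomial α (f.coeff α) + MvPolynomial.monomial β (f.coeff β) := by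
  classical
  ext m
  simp only [MvPolynomial.coeff_sub, MvPolynomial.coeff_one, MvPolynomial.coeff_add,
    MvPolynomial.coeff_monomial]
  by_cases hm0 : m = 0
  · subst hm0; simp [h0, hα, hβ]
  by_cases hmα : m = α
  · subst hmα; simp [Ne.symm hm0, Ne.symm hαβ]
  by_cases hmβ : m = β
  · subst hmβ; simp [Ne.symm hm0, hαβ]
  have hm : m ∉ f.support := fun hm => by
    have := hs hm
    simp [hm0, hmα, hmβ] at this
  rw [MvPolynomial.notMem_support_iff] at hm
  simp [hm, Ne.symm hm0, Ne.symm hmα, Ne.symm hmβ]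

/-- POWER + INJECTIVITY: the coefficient of `X^{p•α+q•β}` in `(a X^α + b X^β)^r` is `[p + q = r] · C(r, p) a^p b^q`
(binomial theorem; `(i, j) ↦ i • α + j • β` is injective). [folklore] -/
theorem coeff_pow_smul_add_smul {α β : Fin 2 →₀ ℕ} (hdet : α 0 * β 1 ≠ α 1 * β 0) (a b : ℂ)
    (r p q : ℕ) :
    MvPolynomial.coeff (p • α + q • β) ((MvPolynomial.monomial α a + MvPolynomial.monomial β b) ^ r) =
      if p + q = r then ((r.choose p : ℕ) : ℂ) * (a ^ p * b ^ q) else 0 := by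
  classical
  rw [(Commute.all _ _).add_pow', MvPolynomial.coeff_sum]
  simp only [MvPolynomial.coeff_smul, MvPolynomial.monomial_pow, MvPolynomial.monomial_mul,
    MvPolynomial.coeff_monomial]
  have hk : ∀ x : ℕ × ℕ, (x.1 • α + x.2 • β = p • α + q • β) ↔ x = (p, q) := fun x =>
    ⟨fun h => Prod.ext_iff.2 (smul_add_smul_inj hdet h), fun h => by rw [h]⟩
  simp_rw [hk, smul_ite, smul_zero, Finset.sum_ite_eq', Finset.HasAntidiagonal.mem_antidiagonal, nsmul_eq_mul]

/-- Off the lattice `ℕ • α + ℕ • β` every coefficient of `(a X^α + b X^β)^r` vanishes. [folklore] -/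
theorem coeff_pow_eq_zero_of_forall_ne {α β : Fin 2 →₀ ℕ} (a b : ℂ) (r : ℕ) (e : Fin 2 →₀ ℕ)
    (he : ∀ p q : ℕ, p • α + q • β ≠ e) :
    MvPolynomial.coeff e ((MvPolynomial.monomial α a + MvPolynomial.monomial β b) ^ r) = 0 := by
  classical
  rw [(Commute.all _ _).add_pow', MvPolynomial.coeff_sum]
  refine Finset.sum_eq_zero fun x _ => ?_
  simp only [MvPolynomial.coeff_smul, MvPolynomial.monomial_pow, MvPolynomial.monomial_mul,
    MvPolynomial.coeff_monomial, if_neg (he x.1 x.2), smul_zero]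

/-- COEFFICIENT FORMULA: on a common cone, the coefficient of `X^{p•α+q•β}` in the truncated log series `Λ_R` is
`[1 ≤ p+q ≤ R] · ((−1)^{p+q+1}/(p+q)) · C(p+q, p) · G(p,q)` with
`G(p,q) = Σ_i a_i^p b_i^q − Σ_i a'_i^p b'_i^q`. [folklore] -/
theorem coeff_logSeries_smul_add_smul {n : ℕ} (u v : Fin n → MvPolynomial (Fin 2) ℂ) {α β : Fin 2 →₀ ℕ}
    (hdet : α 0 * β 1 ≠ α 1 * β 0) (a b a' b' : Fin n → ℂ)
    (hu : ∀ i, u i - 1 = MvPolynomial.monomial α (a i) + MvPolynomial.monomial β (b i))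
    (hv : ∀ i, v i - 1 = MvPolynomial.monomial α (a' i) + MvPolynomial.monomial β (b' i))
    (R p q : ℕ) :
    MvPolynomial.coeff (p • α + q • β) (∑ r ∈ Finset.Icc 1 R, ((-1 : ℂ) ^ (r + 1) / (r : ℂ)) •
        (∑ i, (u i - 1) ^ r - ∑ i, (v i - 1) ^ r)) =
      if 1 ≤ p + q ∧ p + q ≤ R then
        ((-1 : ℂ) ^ (p + q + 1) / ((p + q : ℕ) : ℂ)) * ((((p + q).choose p : ℕ) : ℂ) *
          (∑ i, a i ^ p * b i ^ q - ∑ i, a' i ^ p * b' i ^ q)) else 0 := by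
  classical
  simp only [MvPolynomial.coeff_sum, MvPolynomial.coeff_smul, MvPolynomial.coeff_sub, hu, hv,
    coeff_pow_smul_add_smul hdet, smul_eq_mul]
  by_cases h : 1 ≤ p + q ∧ p + q ≤ R
  · rw [if_pos h, Finset.sum_eq_single (p + q)]
    · simp [Finset.mul_sum, mul_sub]
    · intro r _ hr
      simp [Ne.symm hr]
    · intro habs
      exact absurd (Finset.mem_Icc.2 h) habs
  · rw [if_neg h]
    refine Finset.sum_eq_zero fun r hr => ?_
    have hne : p + q ≠ r := by
      rintro rfl
      exact h (Finset.mem_Icc.1 hr)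
    simp [hne]

/-- Off the lattice `ℕ • α + ℕ • β` every coefficient of `Λ_R` vanishes. [folklore] -/
theorem coeff_logSeries_eq_zero {n : ℕ} (u v : Fin n → MvPolynomial (Fin 2) ℂ) {α β : Fin 2 →₀ ℕ}
    (a b a' b' : Fin n → ℂ)
    (hu : ∀ i, u i - 1 = MvPolynomial.monomial α (a i) + MvPolynomial.monomial β (b i))
    (hv : ∀ i, v i - 1 = MvPolynomial.monomial α (a' i) + MvPolynomial.monomial β (b' i))
    (R : ℕ) (e : Fin 2 →₀ ℕ) (he : ∀ p q : ℕ, p • α + q • β ≠ e) :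
    MvPolynomial.coeff e (∑ r ∈ Finset.Icc 1 R, ((-1 : ℂ) ^ (r + 1) / (r : ℂ)) •
        (∑ i, (u i - 1) ^ r - ∑ i, (v i - 1) ^ r)) = 0 := by
  classical
  simp [MvPolynomial.coeff_sum, MvPolynomial.coeff_smul, MvPolynomial.coeff_sub, hu, hv,
    coeff_pow_eq_zero_of_forall_ne _ _ _ _ he]

/-- SUPPORT of `Λ_R` on a common cone: `e ∈ supp Λ_R ↔ e = p • α + q • β` with `1 ≤ p + q ≤ R` and
`G(p,q) ≠ 0` (the scalar `((−1)^{p+q+1}/(p+q)) · C(p+q, p)` is nonzero in characteristic `0`). [folklore] -/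
theorem mem_support_logSeries_iff {n : ℕ} (u v : Fin n → MvPolynomial (Fin 2) ℂ) {α β : Fin 2 →₀ ℕ}
    (hdet : α 0 * β 1 ≠ α 1 * β 0) (a b a' b' : Fin n → ℂ)
    (hu : ∀ i, u i - 1 = MvPolynomial.monomial α (a i) + MvPolynomial.monomial β (b i))
    (hv : ∀ i, v i - 1 = MvPolynomial.monomial α (a' i) + MvPolynomial.monomial β (b' i))
    (R : ℕ) (e : Fin 2 →₀ ℕ) :
    e ∈ (∑ r ∈ Finset.Icc 1 R, ((-1 : ℂ) ^ (r + 1) / (r : ℂ)) •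
        (∑ i, (u i - 1) ^ r - ∑ i, (v i - 1) ^ r)).support ↔
      ∃ p q : ℕ, e = p • α + q • β ∧ 1 ≤ p + q ∧ p + q ≤ R ∧
        (∑ i, a i ^ p * b i ^ q - ∑ i, a' i ^ p * b' i ^ q) ≠ 0 := by
  rw [MvPolynomial.mem_support_iff]
  constructor
  · intro h
    by_cases hex : ∃ p q : ℕ, p • α + q • β = e
    · obtain ⟨p, q, rfl⟩ := hex
      rw [coeff_logSeries_smul_add_smul u v hdet a b a' b' hu hv] at h
      split_ifs at h with hc
      · exact ⟨p, q, rfl, hc.1, hc.2, fun h0 => h (by rw [h0, mul_zero, mul_zero])⟩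
      · exact absurd rfl h
    · push Not at hex
      exact absurd (coeff_logSeries_eq_zero u v a b a' b' hu hv R e hex) h
  · rintro ⟨p, q, rfl, h1, h2, hG⟩
    rw [coeff_logSeries_smul_add_smul u v hdet a b a' b' hu hv, if_pos ⟨h1, h2⟩]
    refine mul_ne_zero (div_ne_zero (pow_ne_zero _ (by norm_num)) ?_) (mul_ne_zero ?_ hG)
    · exact Nat.cast_ne_zero.2 (by omega)
    · exact Nat.cast_ne_zero.2 (Nat.choose_pos (by omega)).ne'

/-- MINIMALITY: if the supports `S R` are parametrised by the lattice points `(p, q)` with `1 ≤ p + q ≤ R`,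
`G(p,q) ≠ 0` (`α, β ≠ 0`, `G(0,0) = 0`), then a stable unique minimiser (for positive integer weights) is
`p • α + q • β` for a minimal nonzero `(p, q)` of `G` in the componentwise order. [folklore] -/
theorem minimal_of_stable (S : ℕ → Finset (Fin 2 →₀ ℕ)) {α β : Fin 2 →₀ ℕ} (hα : α ≠ 0) (hβ : β ≠ 0)
    (G : ℕ → ℕ → ℂ) (hG0 : G 0 0 = 0)
    (hS : ∀ R e, e ∈ S R ↔ ∃ p q : ℕ, e = p • α + q • β ∧ 1 ≤ p + q ∧ p + q ≤ R ∧ G p q ≠ 0)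
    (e : Fin 2 →₀ ℕ) (w : Fin 2 → ℤ) (hw0 : 0 < w 0) (hw1 : 0 < w 1)
    (hst : ∀ R : ℕ, w 0 * (e 0 : ℤ) + w 1 * (e 1 : ℤ) < (R : ℤ) →
      (e ∈ S R ∧ ∀ e' ∈ S R, e' ≠ e →
        w 0 * (e 0 : ℤ) + w 1 * (e 1 : ℤ) < w 0 * (e' 0 : ℤ) + w 1 * (e' 1 : ℤ))) :
    ∃ x : ℕ × ℕ, e = x.1 • α + x.2 • β ∧ G x.1 x.2 ≠ 0 ∧
      ∀ y : ℕ × ℕ, y.1 ≤ x.1 → y.2 ≤ x.2 → y ≠ x → G y.1 y.2 = 0 := by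
  set ω : ℤ := w 0 * (e 0 : ℤ) + w 1 * (e 1 : ℤ) with hω
  have hR : ω < ((ω.toNat + 1 : ℕ) : ℤ) := by
    have := Int.self_le_toNat ω; push_cast; omega
  obtain ⟨hmem, hmin⟩ := hst _ hR
  obtain ⟨p, q, hepq, _, h2, hG⟩ := (hS _ _).1 hmem
  refine ⟨(p, q), hepq, hG, fun y hp hq hne => ?_⟩
  by_contra hG'
  have hlt : y.1 < p ∨ y.2 < q := by
    by_contra hcon
    push Not at hcon
    exact hne (Prod.ext (le_antisymm hp hcon.1) (le_antisymm hq hcon.2))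
  have hpos : 1 ≤ y.1 + y.2 := by
    by_contra h0
    obtain ⟨h01, h02⟩ : y.1 = 0 ∧ y.2 = 0 := by omega
    rw [h01, h02] at hG'
    exact hG' hG0
  have hmem' : y.1 • α + y.2 • β ∈ S (ω.toNat + 1) :=
    (hS _ _).2 ⟨y.1, y.2, rfl, hpos, by simp only at hp hq; omega, hG'⟩
  -- the weight of `y.1 • α + y.2 • β` is strictly below `ω`
  obtain ⟨Wα, hWα⟩ : ∃ x : ℤ, x = w 0 * (α 0 : ℤ) + w 1 * (α 1 : ℤ) := ⟨_, rfl⟩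
  obtain ⟨Wβ, hWβ⟩ : ∃ x : ℤ, x = w 0 * (β 0 : ℤ) + w 1 * (β 1 : ℤ) := ⟨_, rfl⟩
  have hαpos : (1 : ℤ) ≤ Wα := by
    have hsum : α 0 + α 1 ≠ 0 := fun h => hα (by ext i; fin_cases i <;> simp <;> omega)
    have h0 : (α 0 : ℤ) ≤ w 0 * (α 0 : ℤ) := le_mul_of_one_le_left (by positivity) (by omega)
    have h1 : (α 1 : ℤ) ≤ w 1 * (α 1 : ℤ) := le_mul_of_one_le_left (by positivity) (by omega)
    omega
  have hβpos : (1 : ℤ) ≤ Wβ := by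
    have hsum : β 0 + β 1 ≠ 0 := fun h => hβ (by ext i; fin_cases i <;> simp <;> omega)
    have h0 : (β 0 : ℤ) ≤ w 0 * (β 0 : ℤ) := le_mul_of_one_le_left (by positivity) (by omega)
    have h1 : (β 1 : ℤ) ≤ w 1 * (β 1 : ℤ) := le_mul_of_one_le_left (by positivity) (by omega)
    omega
  have hωe : ω = (p : ℤ) * Wα + (q : ℤ) * Wβ := by
    rw [hω, hepq, hWα, hWβ]
    simp only [Finsupp.add_apply, Finsupp.smul_apply, smul_eq_mul, Nat.cast_add, Nat.cast_mul]
    ring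
  have hωy : w 0 * ((y.1 • α + y.2 • β : Fin 2 →₀ ℕ) 0 : ℤ) + w 1 * ((y.1 • α + y.2 • β : Fin 2 →₀ ℕ) 1 : ℤ)
      = (y.1 : ℤ) * Wα + (y.2 : ℤ) * Wβ := by
    rw [hWα, hWβ]
    simp only [Finsupp.add_apply, Finsupp.smul_apply, smul_eq_mul, Nat.cast_add, Nat.cast_mul]
    ring
  have hlt' : (y.1 : ℤ) * Wα + (y.2 : ℤ) * Wβ < (p : ℤ) * Wα + (q : ℤ) * Wβ := by
    have hp' : (y.1 : ℤ) ≤ p := by exact_mod_cast hp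
    have hq' : (y.2 : ℤ) ≤ q := by exact_mod_cast hq
    rcases hlt with h | h
    · have h' : (y.1 : ℤ) + 1 ≤ p := by exact_mod_cast h
      nlinarith [mul_le_mul_of_nonneg_right h' (by omega : (0 : ℤ) ≤ Wα),
        mul_le_mul_of_nonneg_right hq' (by omega : (0 : ℤ) ≤ Wβ)]
    · have h' : (y.2 : ℤ) + 1 ≤ q := by exact_mod_cast h
      nlinarith [mul_le_mul_of_nonneg_right hp' (by omega : (0 : ℤ) ≤ Wα),
        mul_le_mul_of_nonneg_right h' (by omega : (0 : ℤ) ≤ Wβ)]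
  rcases eq_or_ne (y.1 • α + y.2 • β) e with heq | hne'
  · rw [heq, ← hω, hωe] at hωy
    exact lt_irrefl _ (hωy ▸ hlt')
  · have := hmin _ hmem' hne'
    rw [hωy, hωe] at this
    exact lt_asymm this hlt'

/-- COUNT (rank obstruction, finite form): a finite set of minimal nonzeros of a rank-`≤ N` pattern
`G p q = Σ_{j<N} A_j(p) B_j(q)` has at most `N` elements (sort by `p`; `Negative.card_corners_le_rank`). [folklore] -/
theorem card_le_of_minimal_nonzeros {N : ℕ} (A B : Fin N → ℕ → ℂ) (G : ℕ → ℕ → ℂ)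
    (hG : ∀ p q, G p q = ∑ j, A j p * B j q) (T : Finset (ℕ × ℕ)) (hne : ∀ x ∈ T, G x.1 x.2 ≠ 0)
    (hmin : ∀ x ∈ T, ∀ y : ℕ × ℕ, y.1 ≤ x.1 → y.2 ≤ x.2 → y ≠ x → G y.1 y.2 = 0) : T.card ≤ N := by
  classical
  have hinj : Set.InjOn Prod.fst (T : Set (ℕ × ℕ)) := by
    intro x hx y hy h
    rcases le_total x.2 y.2 with h2 | h2
    · by_contra hxy
      exact hne x hx (hmin y hy x h.le h2 hxy)
    · by_contra hxy
      exact hne y hy (hmin x hx y h.ge h2 (Ne.symm hxy))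
  have hcard : (T.image Prod.fst).card = T.card := Finset.card_image_of_injOn hinj
  have hmem : ∀ k : Fin (T.image Prod.fst).card, ∃ x ∈ T, x.1 = (T.image Prod.fst).orderEmbOfFin rfl k :=
    fun k => Finset.mem_image.1 ((T.image Prod.fst).orderEmbOfFin_mem rfl k)
  choose x hxT hx using hmem
  rw [← hcard]
  refine Summit.ValiantsHypothesis.ValiantsHypothesis.Theorems.TwoProducts.Negative.card_corners_le_rank A B G hG
    (fun k => (T.image Prod.fst).orderEmbOfFin rfl k) (fun k => (x k).2) (fun k => ?_) (fun i k hik => ?_)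
  · rw [← hx k]; exact hne _ (hxT k)
  · refine hmin (x k) (hxT k) ((T.image Prod.fst).orderEmbOfFin rfl i, (x k).2) ?_ le_rfl ?_
    · show (T.image Prod.fst).orderEmbOfFin rfl i ≤ (x k).1
      rw [hx k]
      exact (((T.image Prod.fst).orderEmbOfFin rfl).strictMono hik).le
    · intro h
      have h1 : (T.image Prod.fst).orderEmbOfFin rfl i = (x k).1 := congrArg Prod.fst h
      rw [hx k] at h1
      exact (((T.image Prod.fst).orderEmbOfFin rfl).strictMono hik).ne h1

/-- COUNT (sets of stable vertices): under the lattice parametrisation of the supports by the nonzeros of a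
rank-`≤ N` pattern `G` with `G(0,0) = 0`, any set of stable unique minimisers has `ncard ≤ N`. [folklore] -/
theorem ncard_le_of_rank (S : ℕ → Finset (Fin 2 →₀ ℕ)) {α β : Fin 2 →₀ ℕ} (hα : α ≠ 0) (hβ : β ≠ 0)
    {N : ℕ} (A B : Fin N → ℕ → ℂ) (G : ℕ → ℕ → ℂ) (hG : ∀ p q, G p q = ∑ j, A j p * B j q)
    (hG0 : G 0 0 = 0)
    (hS : ∀ R e, e ∈ S R ↔ ∃ p q : ℕ, e = p • α + q • β ∧ 1 ≤ p + q ∧ p + q ≤ R ∧ G p q ≠ 0)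
    (LV : Set (Fin 2 →₀ ℕ))
    (hLV : ∀ e ∈ LV, ∃ w : Fin 2 → ℤ, 0 < w 0 ∧ 0 < w 1 ∧
      ∀ R : ℕ, w 0 * (e 0 : ℤ) + w 1 * (e 1 : ℤ) < (R : ℤ) →
        (e ∈ S R ∧ ∀ e' ∈ S R, e' ≠ e →
          w 0 * (e 0 : ℤ) + w 1 * (e 1 : ℤ) < w 0 * (e' 0 : ℤ) + w 1 * (e' 1 : ℤ))) :
    LV.ncard ≤ N := by
  classical
  have hfin : ∀ S' : Finset (Fin 2 →₀ ℕ), (↑S' : Set (Fin 2 →₀ ℕ)) ⊆ LV → S'.card ≤ N := by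
    intro S' hS'
    have key : ∀ e ∈ S', ∃ x : ℕ × ℕ, e = x.1 • α + x.2 • β ∧ G x.1 x.2 ≠ 0 ∧
        ∀ y : ℕ × ℕ, y.1 ≤ x.1 → y.2 ≤ x.2 → y ≠ x → G y.1 y.2 = 0 := by
      intro e he
      obtain ⟨w, hw0, hw1, hst⟩ := hLV e (hS' he)
      exact minimal_of_stable S hα hβ G hG0 hS e w hw0 hw1 hst
    choose! π hπ1 hπ2 hπ3 using key
    have hinj : Set.InjOn π ↑S' := fun e he e' he' h => by
      rw [hπ1 e he, hπ1 e' he', h]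
    rw [← Finset.card_image_of_injOn hinj]
    refine card_le_of_minimal_nonzeros A B G hG _ ?_ ?_
    · simp only [Finset.mem_image]
      rintro _ ⟨e, he, rfl⟩
      exact hπ2 e he
    · simp only [Finset.mem_image]
      rintro _ ⟨e, he, rfl⟩
      exact hπ3 e he
  rcases LV.finite_or_infinite with hf | hinf
  · rw [Set.ncard_eq_toFinset_card _ hf]
    exact hfin _ (by simp)
  · rw [hinf.ncard]
    exact Nat.zero_le _

/-- RANK FORM: `G(p,q) = Σ_i a_i^p b_i^q − Σ_i a'_i^p b'_i^q` is a pattern of rank `≤ n + n`. [folklore] -/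
theorem expSum_sub_expSum_eq {n : ℕ} (a b a' b' : Fin n → ℂ) (p q : ℕ) :
    (∑ i, a i ^ p * b i ^ q - ∑ i, a' i ^ p * b' i ^ q) =
      ∑ j : Fin (n + n), Fin.append (fun i (p : ℕ) => a i ^ p) (fun i p => -(a' i ^ p)) j p *
        Fin.append (fun i (q : ℕ) => b i ^ q) (fun i q => b' i ^ q) j q := by
  rw [Fin.sum_univ_add]
  simp only [Fin.append_left, Fin.append_right]
  simp [sub_eq_add_neg]

/-- STUB `stub_engineCommonCone` (the RANK RUNG of the engine): if all `2n` factors have constant term `1` and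
support inside `{0, α, β}` for two independent exponents `α, β` (`α 0 * β 1 ≠ α 1 * β 0`), the set of stable
south-west vertices of the truncated log series `Λ_R = Σ_{r=1}^{R} ((−1)^{r+1}/r) • (Σ_i (u_i − 1)^r − Σ_i (v_i − 1)^r)`
has at most `2n` elements. [folklore] -/
theorem stub_engineCommonCone : ∀ (n : ℕ) (u v : Fin n → MvPolynomial (Fin 2) ℂ) (α β : Fin 2 →₀ ℕ), α 0 * β 1 ≠ α 1 * β 0 → (∀ i, MvPolynomial.coeff 0 (u i) = 1) → (∀ i, MvPolynomial.coeff 0 (v i) = 1) → (∀ i, (u i).support ⊆ {0, α, β}) → (∀ i, (v i).support ⊆ {0, α, β}) → ({e : Fin 2 →₀ ℕ | ∃ w : Fin 2 → ℤ, 0 < w 0 ∧ 0 < w 1 ∧ ∀ R : ℕ, ((w) 0 * ((e) 0 : ℤ) + (w) 1 * ((e) 1 : ℤ)) < (R : ℤ) → ((e) ∈ ((∑ r ∈ Finset.Icc 1 R, ((-1 : ℂ) ^ (r + 1) / (r : ℂ)) • (∑ i, (u i - 1) ^ r - ∑ i, (v i - 1) ^ r)).support) ∧ ∀ e' ∈ ((∑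 r ∈ Finset.Icc 1 R, ((-1 : ℂ) ^ (r + 1) / (r : ℂ)) • (∑ i, (u i - 1) ^ r - ∑ i, (v i - 1) ^ r)).support), e' ≠ (e) → ((w) 0 * ((e) 0 : ℤ) + (w) 1 * ((e) 1 : ℤ)) < ((w) 0 * ((e') 0 : ℤ) + (w) 1 * ((e') 1 : ℤ)))}).ncard ≤ 2 * n := by
  intro n u v α β hdet hu0 hv0 hu hv
  classical
  obtain ⟨hα, hβ, hαβ⟩ := ne_zero_of_det hdet
  have hus : ∀ i, u i - 1 = MvPolynomial.monomial α ((u i).coeff α) + MvPolynomial.monomial β ((u i).coeff β) :=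
    fun i => sub_one_eq_of_support_subset hα hβ hαβ (u i) (hu0 i) (hu i)
  have hvs : ∀ i, v i - 1 = MvPolynomial.monomial α ((v i).coeff α) + MvPolynomial.monomial β ((v i).coeff β) :=
    fun i => sub_one_eq_of_support_subset hα hβ hαβ (v i) (hv0 i) (hv i)
  refine le_trans (ncard_le_of_rank
    (fun R => (∑ r ∈ Finset.Icc 1 R, ((-1 : ℂ) ^ (r + 1) / (r : ℂ)) •
      (∑ i, (u i - 1) ^ r - ∑ i, (v i - 1) ^ r)).support) hα hβ _ _
    (fun p q => ∑ i, (u i).coeff α ^ p * (u i).coeff β ^ q - ∑ i, (v i).coeff α ^ p * (v i).coeff β ^ q)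
    (fun p q => expSum_sub_expSum_eq _ _ _ _ p q) (by simp)
    (fun R e => mem_support_logSeries_iff u v hdet _ _ _ _ hus hvs R e) _ (fun e he => he)) ?_
  omega
end Summit.ValiantsHypothesis.ValiantsHypothesis.Theorems.TwoProducts.CommonCone
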